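import Summits.RiemannHypothesis.RiemannHypothesis.Theorems.WeilGroundStateArchimedeanWindowSimpleEvenGapDefs
import Literature.NumberTheory.LFunctions.WeilMarkovQuadratic
import HarnessLib

/-!
# `ArchimedeanWindowSimpleEven` — the trial function, I: basic facts and the increment form

The parabolic bump `h = trialFun = (1 − 9x²)⁺` (support `[-1/3, 1/3] ⊆ [-(log 2)/2, (log 2)/2]`):
continuity, compact support, `L²`, `‖h‖₂² = 16/45`, and the increment form in closed form,
`D_t(h) = 8t² − 12t³ + (27/5)t⁵` for `0 ≤ t ≤ 2/3`, `D_t(h) = 32/45` for `t ≥ 2/3`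
(the correlation `∫ h(x+t)h(x) dx = 16/45 − 4t² + 6t³ − (27/10)t⁵` is a polynomial integral).

Route `RiemannHypothesis/WeilGroundState`, item `ArchimedeanWindowSimpleEven` (stmt-RiemannHypothesis-1529).
See `WeilGroundStateArchimedeanWindowSimpleEvenGapDefs.lean` for the certificate format, the data and the
overall plan (LOWER bounds by the gap certificate `weilGapCert`, UPPER bound `ε((log 2)/2) ≤ 3/200` by the
trial function `trialFun`).
-/

namespace Summit.RiemannHypothesis.RiemannHypothesis.Theorems.WeilGroundState

open Literature.NumberTheory.LFunctions

/-! ## The trial function `h(x) = max(1 − 9x², 0)`: basic facts and the increment form -/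

section Trial

open Complex Finset MeasureTheory Set Filter
open scoped Real ComplexConjugate BigOperators

/-- Unfolding `trialFun`. [folklore] -/
theorem trialFun_apply (x : ℝ) : trialFun x = ((max (1 - 9 * x ^ 2) 0 : ℝ) : ℂ) := rfl

/-- On `9x² ≤ 1` the trial function is the parabola `1 − 9x²`. [folklore] -/
theorem trialFun_of_sq_le {x : ℝ} (hx : 9 * x ^ 2 ≤ 1) : trialFun x = ((1 - 9 * x ^ 2 : ℝ) : ℂ) := by
  rw [trialFun_apply, max_eq_left (by linarith)]

/-- Off `9x² < 1` the trial function vanishes. [folklore] -/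
theorem trialFun_of_le_sq {x : ℝ} (hx : 1 ≤ 9 * x ^ 2) : trialFun x = 0 := by
  rw [trialFun_apply, max_eq_right (by linarith), Complex.ofReal_zero]

/-- If `trialFun x ≠ 0` then `9x² < 1`. [folklore] -/
theorem sq_lt_of_trialFun_ne_zero {x : ℝ} (hx : trialFun x ≠ 0) : 9 * x ^ 2 < 1 := by
  by_contra h
  exact hx (trialFun_of_le_sq (not_lt.1 h))

/-- `9x² < 1 ↔ -1/3 < x < 1/3`. [folklore] -/
theorem sq_lt_one_iff {x : ℝ} : 9 * x ^ 2 < 1 ↔ -(1 / 3 : ℝ) < x ∧ x < 1 / 3 := by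
  constructor
  · intro h
    constructor <;> nlinarith
  · rintro ⟨h1, h2⟩
    nlinarith

/-- The trial function is continuous. [folklore] -/
theorem continuous_trialFun : Continuous trialFun :=
  Complex.continuous_ofReal.comp
    ((continuous_const.sub (continuous_const.mul (continuous_pow 2))).max continuous_const)

/-- The trial function vanishes off `[-1/3, 1/3]`. [folklore] -/
theorem trialFun_eq_zero_of_not_mem {x : ℝ} (hx : x ∉ Icc (-(1 / 3 : ℝ)) (1 / 3)) : trialFun x = 0 := by
  by_contra h
  have := sq_lt_one_iff.1 (sq_lt_of_trialFun_ne_zero h)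
  exact hx ⟨this.1.le, this.2.le⟩

/-- The trial function has compact support. [folklore] -/
theorem hasCompactSupport_trialFun : HasCompactSupport trialFun :=
  HasCompactSupport.intro isCompact_Icc fun _ hx ↦ trialFun_eq_zero_of_not_mem hx

/-- The trial function is in `L²`. [folklore] -/
theorem memLp_trialFun : MemLp trialFun 2 volume :=
  continuous_trialFun.memLp_of_hasCompactSupport hasCompactSupport_trialFun

/-- The trial function vanishes off the archimedean window `[-(log 2)/2, (log 2)/2] ⊇ [-1/3, 1/3]`. [folklore] -/
theorem trialFun_eq_zero_of_not_mem_window {x : ℝ}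
    (hx : x ∉ Icc (-(Real.log 2 / 2)) (Real.log 2 / 2)) : trialFun x = 0 := by
  refine trialFun_eq_zero_of_not_mem fun h ↦ hx ⟨?_, ?_⟩
  · have := Real.log_two_gt_d9; linarith [h.1]
  · have := Real.log_two_gt_d9; linarith [h.2]

/-- Integral of a quartic over an interval. [folklore] -/
theorem integral_poly4 (a b c0 c1 c2 c3 c4 : ℝ) :
    ∫ x in a..b, (c0 + c1 * x + c2 * x ^ 2 + c3 * x ^ 3 + c4 * x ^ 4) =
      c0 * (b - a) + c1 * ((b ^ 2 - a ^ 2) / 2) + c2 * ((b ^ 3 - a ^ 3) / 3) +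
        c3 * ((b ^ 4 - a ^ 4) / 4) + c4 * ((b ^ 5 - a ^ 5) / 5) := by
  have i0 : IntervalIntegrable (fun x : ℝ ↦ c0) volume a b := intervalIntegrable_const
  have i1 : IntervalIntegrable (fun x : ℝ ↦ c1 * x) volume a b :=
    (continuous_const.mul continuous_id).intervalIntegrable _ _
  have i2 : IntervalIntegrable (fun x : ℝ ↦ c2 * x ^ 2) volume a b :=
    (continuous_const.mul (continuous_pow 2)).intervalIntegrable _ _
  have i3 : IntervalIntegrable (fun x : ℝ ↦ c3 * x ^ 3) volume a b :=
    (continuous_const.mul (continuous_pow 3)).intervalIntegrable _ _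
  have i4 : IntervalIntegrable (fun x : ℝ ↦ c4 * x ^ 4) volume a b :=
    (continuous_const.mul (continuous_pow 4)).intervalIntegrable _ _
  rw [intervalIntegral.integral_add (((i0.add i1).add i2).add i3) i4,
    intervalIntegral.integral_add ((i0.add i1).add i2) i3,
    intervalIntegral.integral_add (i0.add i1) i2, intervalIntegral.integral_add i0 i1,
    intervalIntegral.integral_const, intervalIntegral.integral_const_mul,
    intervalIntegral.integral_const_mul, intervalIntegral.integral_const_mul,
    intervalIntegral.integral_const_mul, integral_pow, integral_pow, integral_pow,
    show (∫ x in a..b, x) = (b ^ 2 - a ^ 2) / 2 from integral_id]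
  simp only [smul_eq_mul]
  push_cast
  ring

/-- `‖h‖₂² = 16/45`. [folklore] -/
theorem integral_norm_sq_trialFun : ∫ x, ‖trialFun x‖ ^ 2 = 16 / 45 := by
  have h1 : ∫ x, ‖trialFun x‖ ^ 2 = ∫ x in (-(1 / 3 : ℝ))..(1 / 3), ‖trialFun x‖ ^ 2 := by
    symm
    apply intervalIntegral.integral_eq_integral_of_support_subset
    intro x hx
    have hne : trialFun x ≠ 0 := fun h ↦ hx (by simp [h])
    have := sq_lt_one_iff.1 (sq_lt_of_trialFun_ne_zero hne)
    exact ⟨this.1, this.2.le⟩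
  have h2 : ∫ x in (-(1 / 3 : ℝ))..(1 / 3), ‖trialFun x‖ ^ 2 =
      ∫ x in (-(1 / 3 : ℝ))..(1 / 3), ((1 : ℝ) + 0 * x + (-18) * x ^ 2 + 0 * x ^ 3 + 81 * x ^ 4) := by
    refine intervalIntegral.integral_congr fun x hx ↦ ?_
    rw [Set.uIcc_of_le (by norm_num)] at hx
    have hx' : 9 * x ^ 2 ≤ 1 := by nlinarith [hx.1, hx.2]
    rw [trialFun_of_sq_le hx', Complex.norm_real, Real.norm_eq_abs, sq_abs]
    ring
  rw [h1, h2, integral_poly4]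
  norm_num

/-- Pointwise, the increment integrand of the (real) trial function. [folklore] -/
theorem norm_trialFun_sub_sq (x y : ℝ) :
    ‖trialFun x - trialFun y‖ ^ 2 =
      ‖trialFun x‖ ^ 2 + ‖trialFun y‖ ^ 2 -
        2 * (max (1 - 9 * x ^ 2) 0 * max (1 - 9 * y ^ 2) 0) := by
  simp only [trialFun_apply, ← Complex.ofReal_sub, Complex.norm_real, Real.norm_eq_abs, sq_abs]
  ring

/-- The correlation `A(t) = ∫ h(x + t) h(x) dx` vanishes pointwise outside the overlap. [folklore] -/
theorem trialProd_eq_zero {t x : ℝ} (hx : x ∉ Ioo (-(1 / 3 : ℝ)) (1 / 3 - t)) :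
    max (1 - 9 * (x + t) ^ 2) 0 * max (1 - 9 * x ^ 2) 0 = 0 := by
  by_cases h1 : 9 * x ^ 2 < 1
  · have h2 : ¬ 9 * (x + t) ^ 2 < 1 := by
      intro h2
      have a1 := sq_lt_one_iff.1 h1
      have a2 := sq_lt_one_iff.1 h2
      exact hx ⟨a1.1, by linarith [a2.2]⟩
    rw [max_eq_right (by linarith), zero_mul]
  · rw [max_eq_right (by linarith : 1 - 9 * x ^ 2 ≤ 0), mul_zero]

/-- **The correlation of the trial function**: for `0 ≤ t ≤ 2/3`,
`∫ h(x+t) h(x) dx = 16/45 − 4t² + 6t³ − (27/10) t⁵`. [folklore] -/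
theorem integral_trialProd_of_le {t : ℝ} (ht0 : 0 ≤ t) (ht : t ≤ 2 / 3) :
    ∫ x, max (1 - 9 * (x + t) ^ 2) 0 * max (1 - 9 * x ^ 2) 0 =
      16 / 45 - 4 * t ^ 2 + 6 * t ^ 3 - 27 / 10 * t ^ 5 := by
  have h1 : ∫ x, max (1 - 9 * (x + t) ^ 2) 0 * max (1 - 9 * x ^ 2) 0 =
      ∫ x in (-(1 / 3 : ℝ))..(1 / 3 - t), max (1 - 9 * (x + t) ^ 2) 0 * max (1 - 9 * x ^ 2) 0 := by
    symm
    apply intervalIntegral.integral_eq_integral_of_support_subset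
    intro x hx
    rw [Function.mem_support] at hx
    by_contra hx'
    exact hx (trialProd_eq_zero fun h ↦ hx' ⟨h.1, h.2.le⟩)
  have h2 : ∫ x in (-(1 / 3 : ℝ))..(1 / 3 - t), max (1 - 9 * (x + t) ^ 2) 0 * max (1 - 9 * x ^ 2) 0 =
      ∫ x in (-(1 / 3 : ℝ))..(1 / 3 - t),
        ((1 - 9 * t ^ 2) + (-18 * t) * x + (-(18 : ℝ) + 81 * t ^ 2) * x ^ 2 + (162 * t) * x ^ 3 +
          81 * x ^ 4) := by
    refine intervalIntegral.integral_congr fun x hx ↦ ?_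
    rw [Set.uIcc_of_le (by linarith)] at hx
    have hx1 : 9 * x ^ 2 ≤ 1 := by nlinarith [hx.1, hx.2]
    have hx2 : 9 * (x + t) ^ 2 ≤ 1 := by nlinarith [hx.1, hx.2]
    rw [max_eq_left (by linarith), max_eq_left (by linarith)]
    ring
  rw [h1, h2, integral_poly4]
  ring

/-- For `t ≥ 2/3` the translate and the function have disjoint supports: `∫ h(x+t) h(x) dx = 0`. [folklore] -/
theorem integral_trialProd_of_ge {t : ℝ} (ht : 2 / 3 ≤ t) :
    ∫ x, max (1 - 9 * (x + t) ^ 2) 0 * max (1 - 9 * x ^ 2) 0 = 0 := by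
  refine integral_eq_zero_of_ae (Eventually.of_forall fun x ↦ trialProd_eq_zero ?_)
  rintro ⟨h1, h2⟩
  linarith

/-- The product `h(x+t) h(x)` is integrable (continuous with compact support). [folklore] -/
theorem integrable_trialProd (t : ℝ) :
    Integrable fun x : ℝ ↦ max (1 - 9 * (x + t) ^ 2) 0 * max (1 - 9 * x ^ 2) 0 := by
  have hc : Continuous fun x : ℝ ↦ max (1 - 9 * (x + t) ^ 2) 0 * max (1 - 9 * x ^ 2) 0 := by
    fun_prop
  refine hc.integrable_of_hasCompactSupport (HasCompactSupport.intro (K := Icc (-(1 / 3 : ℝ)) (1 / 3))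
    isCompact_Icc fun x hx ↦ ?_)
  have : ¬ 9 * x ^ 2 < 1 := fun h ↦ hx ⟨(sq_lt_one_iff.1 h).1.le, (sq_lt_one_iff.1 h).2.le⟩
  rw [max_eq_right (by linarith : 1 - 9 * x ^ 2 ≤ 0), mul_zero]

/-- **The increment form of the trial function**:
`D_t(h) = 32/45 − 2 ∫ h(x+t) h(x) dx`. [folklore] -/
theorem weilIncrement_trialFun_eq (t : ℝ) :
    weilIncrement trialFun t = 32 / 45 - 2 * ∫ x, max (1 - 9 * (x + t) ^ 2) 0 * max (1 - 9 * x ^ 2) 0 := by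
  unfold weilIncrement
  simp_rw [norm_trialFun_sub_sq]
  have i1 : Integrable fun x : ℝ ↦ ‖trialFun (x + t)‖ ^ 2 :=
    ((memLp_two_iff_integrable_sq_norm memLp_trialFun.1).1 memLp_trialFun).comp_add_right t
  have i2 : Integrable fun x : ℝ ↦ ‖trialFun x‖ ^ 2 :=
    (memLp_two_iff_integrable_sq_norm memLp_trialFun.1).1 memLp_trialFun
  have i12 : Integrable fun x : ℝ ↦ ‖trialFun (x + t)‖ ^ 2 + ‖trialFun x‖ ^ 2 := i1.add i2
  have i3 : Integrable fun x : ℝ ↦ 2 * (max (1 - 9 * (x + t) ^ 2) 0 * max (1 - 9 * x ^ 2) 0) :=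
    (integrable_trialProd t).const_mul 2
  rw [integral_sub i12 i3, integral_add i1 i2, integral_const_mul,
    integral_add_right_eq_self (fun x : ℝ ↦ ‖trialFun x‖ ^ 2) t, integral_norm_sq_trialFun]
  norm_num

/-- `D_t(h) = 8t² − 12t³ + (27/5)t⁵` for `0 ≤ t ≤ 2/3`. [folklore] -/
theorem weilIncrement_trialFun_of_le {t : ℝ} (ht0 : 0 ≤ t) (ht : t ≤ 2 / 3) :
    weilIncrement trialFun t = 8 * t ^ 2 - 12 * t ^ 3 + 27 / 5 * t ^ 5 := by
  rw [weilIncrement_trialFun_eq, integral_trialProd_of_le ht0 ht]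
  ring

/-- `D_t(h) = 32/45 = 2‖h‖₂²` for `t ≥ 2/3`. [folklore] -/
theorem weilIncrement_trialFun_of_ge {t : ℝ} (ht : 2 / 3 ≤ t) :
    weilIncrement trialFun t = 32 / 45 := by
  rw [weilIncrement_trialFun_eq, integral_trialProd_of_ge ht]
  norm_num

end Trial

end Summit.RiemannHypothesis.RiemannHypothesis.Theorems.WeilGroundState
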